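import Literature.MathematicalPhysics.QuantumLattice.HubbardThermalDoccFreeEntropyChord
import Literature.MathematicalPhysics.QuantumLattice.HubbardTTPrimeFreeKineticBound
import Literature.MathematicalPhysics.QuantumLattice.FreeFermionPartitionFnDiagonalised
import Literature.MathematicalPhysics.QuantumLattice.FreeFermionSpinTwistedTraceFormula
import HarnessLib

/-!
# The free grand-canonical pressure of the `t–t'` square lattice as a Brillouin-zone integral, and the
# free-gas CEILING of the canonical `t–t'` Hubbard pressure at every `U ≥ 0`

Topic `MathematicalPhysics/QuantumLattice` (family `hubbard`); written 2026-08-28 by `hubbard-downfold-unc-2` (g25, MO-S1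
filling lane of the Hubbard material oracle) as the `t' ≠ 0` twin of §2–§3 of `HubbardThermalDoccFreeEntropyChord`
(hubbard-tc mod-2, `t' = 0` only).

WHY: every hot-anchored `T > 0` competing-order word of the oracle (`HubbardTTPrimeThermalPhaseCoexistenceHotAnchor`,
`Summits/…/Observables/PhaseSeparationExclusionBox*Thermal*`) carries, for the DILUTE partner density `n₁` of the excluded
mixture, the a-priori entropy cap `p(β_h = 0; n₁) ≤ 2 H_b(n₁/2) ∈ [0.67, 1.05]`. The canonical pressure is ANTITONE in `U`
(`pressureTT'_anti_U`), so at every `U ≥ 0` and every `β` it is capped by the FREE `t–t'` gas, whose grand-canonical pressure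
is an explicit two-dimensional integral; with a kernel quadrature ceiling of that integral the dilute bracket drops to
`≈ 0.05–0.08` at `β·t = 8` (the staircase `β_h → β` then runs inside the free gas, on the kinematic tangent row which is exact
there), and the threshold `β₀` of every such word by `16–24 %`.

* §1 `freeLogWeightTT' β t' μ p = 2 log(1 + e^{−β(2 Σᵢ cos pᵢ − 4 t' cos p₀ cos p₁ − μ)})` (corner coordinates `p = c_k` of the
  Brillouin torus, in which the `t–t'` band `ε_L(k) = −2(cos q₀ + cos q₁) − 4t' cos q₀ cos q₁`, `q = c_k + (π, π)`, reads
  `2 Σ cos cᵢ − 4 t' cos c₀ cos c₁`, `ttBand_one_eq_cellCorner`) and `freeGCPressureTT' β t' μ = (2π)⁻² ∫_{[−π,π]²} freeLogWeightTT'`;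
  at `t' = 0` these ARE `freeLogWeight` / `freeGCPressure` (`freeLogWeightTT'_zero`, `freeGCPressureTT'_zero`).
* §2 THE PLANE-WAVE PRODUCT at `t' ≠ 0` (`L ≥ 3`): `log Re Tr e^{−β(H_L(1,t',0) − μN)} = Σ_k freeLogWeightTT' β t' μ (c_k)`
  (`log_partitionFn_freeTT'_eq_sum`): `H_L(1,t',0) − μN = dΓ((A_{tt'} − μ) ⊕ (A_{tt'} − μ))` (`hubbardTorusTT'_zero_sub_mu_eq_dGamma`,
  via `hamiltonianWith_zero_eq_dGamma` and the spin lift `reindex_blockDiagonal_*`), `A_{tt'} = W diag(ε) Wᴴ`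
  (`TTPrimeFree.ttHopMatrix_eq_conj`, plane waves) and the free trace formula for an exactly diagonalised one-body matrix
  (`partitionFn_dGamma_conj_diagonal`) give `Tr = ∏_{(x,σ)} (1 + e^{−β(ε_x − μ)})` (`partitionFn_dGamma_spinLift_conj_sub_smul`,
  generic; `partitionFn_freeTT'_eq_prod`); hence `L⁻² log Ξ_L → freeGCPressureTT'` (`tendsto_log_partitionFn_freeTT'_div_sq`,
  corner Riemann sums). NOTE on instances: the generic spin-lift lemma is stated on the `LinearOrder`-derived `DecidableEq`
  of the tree's generic files; at the concrete torus `FermionTorus 2 L` one `convert` bridges to the computable instance path.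
* §3 THE CEILINGS: `p(β; 1,t',0; n) ≤ P₀(β,t',μ) − βμn` for every real `μ` (`pressureTT'_freeTT'_le_freeGCPressureTT'_sub`, the
  canonical ⇐ grand-canonical ceiling `pressureTT'_add_le_of_grandCanonical_ceiling`), and for EVERY `U ≥ 0`
  `p(β; 1,t',U; n) ≤ P₀(β,t',μ) − βμn` (`pressureTT'_le_freeGCPressureTT'_sub`, antitone in `U`), with reader shapes taking a
  certified `P₀ ≤ P` (`pressureTT'_le_of_freeGCPressureTT'_le`, `…_le'` = the dilute-anchor hypothesis shape
  `p(β_h; 1,t',U; n₁) ≤ π₁` of the hot-anchor law).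
* §4 THE `t'` DOCC CHORD (for the KT back-end of `pub/hubbard-tc`, cuprate point `(U, n, t') = (8, 7/8, −1/4)`):
  `β·U·D(ω) ≤ P₀(β,t',μ) − βμn + β e^{up}` for every thermal torus limit at `(β, 1, t', U, n)` and every certified `T = 0` upper
  `e(1,t',U,n) ≤ e^{up}` (`IsTorusLimitOfMixture.mul_meanEnergy_onSite_le_of_freeGCPressureTT'_of_upper` + reader / word
  shapes) — mod-2's cap «WITHOUT any thermal certificate», now at `t' ≠ 0`.

Everything is PROVED (standard axioms); two definitions with bodies (`freeLogWeightTT'`, `freeGCPressureTT'`), no named fact.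
HONEST SCOPE: one-body thermodynamics of the free gas plus two monotonicity/Legendre facts of the tree; no certificate, no
number, no phase word; the numerical enclosure of `P₀(β,t',μ)` is a separate kernel theorem (`FreeFermionPressureQuadratureTT'`).

## Mathlib / tree search

REUSED: `hamiltonianWith_zero_eq_dGamma`, `dGamma_add`, `hubbardOneBody_apply` (`FermionQuasiFree`);
`reindex_blockDiagonal_{apply,mul,one,diagonal}`, `sum_orb_eq_sum_sum` (`FreeFermionSpinTwistedTraceFormula`);
`partitionFn_dGamma_conj_diagonal` (`FreeFermionPartitionFnDiagonalised`); `TTPrimeFree.ttHopMatrix_eq_conj`, `TTPrimeFree.ttBand`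
(`HubbardTTPrimeFreeKineticBound`); `LangerMattis.sitePlaneWave_mul_conjTranspose`, `LangerMattis.hopMatrix`;
`pressureTT'_add_le_of_grandCanonical_ceiling` (`HubbardTTPrimeThermalPressureGrandCanonicalCeiling`); `pressureTT'_anti_U`,
`pressureTT'_mem_Icc` (`HubbardTTPrimeThermalPressureLimit`); `IsTorusLimitOfMixture.mul_meanEnergy_onSite_le_pressureTT'_add_of_upper`,
`IsTorusLimitOfMixture.meanEnergy_onSite_eq_re_expect_docc`, `freeLogWeight`, `freeGCPressure` (`HubbardThermalDoccFreeEntropyChord`);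
`latticeMomentum_eq_cellCorner_add`, `FermionTorus.sum_eq_sum_torusSite`, `HartreeFock.sum_cellCorner_div_eq`,
`tendsto_cornerRiemannSum`, `invertibleOfRightInverse`, `Matrix.inv_eq_right_inv`.
`rg 'freeGCPressureTT|freeLogWeightTT'` over `lean/`: nothing (2026-08-28).

## References

* N. W. Ashcroft, N. D. Mermin, *Solid State Physics* (1976), Ch. 2 eq. (2.49) (the free grand potential as a sum over
  one-particle levels). [cite: AshcroftMermin1976, Ch. 2 eq. (2.49)]
* D. Ruelle, *Statistical Mechanics: Rigorous Results* (1969), §3.4 (canonical vs grand-canonical pressure). [cite: Ruelle1969, §3.4]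
* E. H. Lieb, *Two theorems on the Hubbard model* and the 1973 concavity-in-the-coupling argument, §V (5.2)–(5.4).
  [cite: Lieb1973, §V (5.2)–(5.4)]
* S. Friedli, Y. Velenik, *Statistical Mechanics of Lattice Systems* (2017), §10.5.2 (plane waves on the torus).
  [cite: FriedliVelenikSMLS2017, §10.5.2]
* H. Xu et al., Science 384 (2024) eadh7691, eq. (1) (the `t–t'` Hubbard model). [cite: XuEtAl2024, eq. (1)]
-/

noncomputable section

namespace Literature.MathematicalPhysics.QuantumLattice

open Real Set MeasureTheory Matrix Finset HubbardWave0 Literature.Probability.LatticeModels ThermodynamicLimit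
open _root_.Filter
open scoped _root_.Topology ComplexOrder BigOperators

/-! ### §1 The free `t–t'` log-weight and grand-canonical pressure -/

/-- The free grand-canonical log-weight of one momentum (both spins) of the `t–t'` square lattice (`t = 1`), in the corner
coordinates `p = c_k` of the Brillouin torus: `2 log(1 + e^{−β(2 Σᵢ cos pᵢ − 4 t' cos p₀ cos p₁ − μ)})`
(`ε_L(k) = 2 Σ cos cᵢ − 4t' cos c₀ cos c₁`, `TTPrimeFree.ttBand` at `q = c + (π,π)`). [cite: AshcroftMermin1976, Ch. 2 eq. (2.49)] -/
def freeLogWeightTT' (β t' μ : ℝ) (p : Fin 2 → ℝ) : ℝ :=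
  2 * Real.log (1 + Real.exp (-(β * (2 * ∑ i, Real.cos (p i) - 4 * t' * (Real.cos (p 0) * Real.cos (p 1)) - μ))))

/-- **The free grand-canonical pressure of the `t–t'` square lattice** (`t = 1`, `U = 0`, both spins, `log` per site):
`P₀(β, t', μ) = (2π)⁻² ∫_{[−π,π]²} 2 log(1 + e^{−β(2(cos p₀ + cos p₁) − 4t' cos p₀ cos p₁ − μ)}) dp`, the limit of
`L⁻² log Tr e^{−β(H_L(1,t',0) − μN)}` (`tendsto_log_partitionFn_freeTT'_div_sq`). [cite: AshcroftMermin1976, Ch. 2 eq. (2.49)] -/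
def freeGCPressureTT' (β t' μ : ℝ) : ℝ :=
  ((2 * π) ^ 2)⁻¹ * ∫ p in brillouin 2, freeLogWeightTT' β t' μ p

/-- At `t' = 0` the `t–t'` log-weight is the square-lattice one. [cite: AshcroftMermin1976, Ch. 2 eq. (2.49)] -/
theorem freeLogWeightTT'_zero (β μ : ℝ) : freeLogWeightTT' β 0 μ = freeLogWeight β μ := by
  funext p
  simp only [freeLogWeightTT', freeLogWeight, mul_zero, zero_mul, sub_zero]

/-- At `t' = 0` the `t–t'` free pressure is `freeGCPressure`. [cite: AshcroftMermin1976, Ch. 2 eq. (2.49)] -/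
theorem freeGCPressureTT'_zero (β μ : ℝ) : freeGCPressureTT' β 0 μ = freeGCPressure β μ := by
  rw [freeGCPressureTT', freeLogWeightTT'_zero, freeGCPressure]

/-- `freeLogWeightTT'` is continuous. [cite: AshcroftMermin1976, Ch. 2 eq. (2.49)] -/
theorem continuous_freeLogWeightTT' (β t' μ : ℝ) : Continuous (freeLogWeightTT' β t' μ) := by
  unfold freeLogWeightTT'
  have harg : Continuous fun p : Fin 2 → ℝ =>
      2 * ∑ i, Real.cos (p i) - 4 * t' * (Real.cos (p 0) * Real.cos (p 1)) - μ := by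
    have hsum : Continuous fun p : Fin 2 → ℝ => ∑ i, Real.cos (p i) :=
      continuous_finsetSum _ fun i _ => Real.continuous_cos.comp (continuous_apply i)
    have h0 : Continuous fun p : Fin 2 → ℝ => Real.cos (p 0) := Real.continuous_cos.comp (continuous_apply 0)
    have h1 : Continuous fun p : Fin 2 → ℝ => Real.cos (p 1) := Real.continuous_cos.comp (continuous_apply 1)
    exact ((continuous_const.mul hsum).sub (continuous_const.mul (h0.mul h1))).sub continuous_const
  have hpos : ∀ p : Fin 2 → ℝ,
      1 + Real.exp (-(β * (2 * ∑ i, Real.cos (p i) - 4 * t' * (Real.cos (p 0) * Real.cos (p 1)) - μ))) ≠ 0 :=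
    fun p => (by positivity : (0 : ℝ) <
      1 + Real.exp (-(β * (2 * ∑ i, Real.cos (p i) - 4 * t' * (Real.cos (p 0) * Real.cos (p 1)) - μ)))).ne'
  exact continuous_const.mul ((continuous_const.add (Real.continuous_exp.comp (continuous_const.mul harg).neg)).log hpos)

/-- `freeLogWeightTT' ≥ 0` (`log(1 + eˣ) ≥ 0`). [cite: AshcroftMermin1976, Ch. 2 eq. (2.49)] -/
theorem freeLogWeightTT'_nonneg (β t' μ : ℝ) (p : Fin 2 → ℝ) : 0 ≤ freeLogWeightTT' β t' μ p := by
  unfold freeLogWeightTT'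
  have h := Real.exp_pos (-(β * (2 * ∑ i, Real.cos (p i) - 4 * t' * (Real.cos (p 0) * Real.cos (p 1)) - μ)))
  exact mul_nonneg zero_le_two (Real.log_nonneg (by linarith))

/-! ### §2 The plane-wave product for the free `t–t'` torus -/

section Torus

variable {L : ℕ}

/-- The `t–t'` band in corner coordinates: `ε_L(k) = 2 Σᵢ cos (c_k)ᵢ − 4 t' cos (c_k)₀ cos (c_k)₁` (`q_k = c_k + (π, π)`).
[cite: FriedliVelenikSMLS2017, §10.5.2] -/
theorem ttBand_one_eq_cellCorner (t' : ℝ) (k : TorusSite 2 L) :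
    TTPrimeFree.ttBand L 1 t' k =
      2 * ∑ i, Real.cos (cellCorner k i) - 4 * t' * (Real.cos (cellCorner k 0) * Real.cos (cellCorner k 1)) := by
  rw [TTPrimeFree.ttBand, latticeMomentum_eq_cellCorner_add]
  simp only [Pi.add_apply, Real.cos_add_pi, Finset.sum_neg_distrib]
  ring

variable [NeZero L]

omit [NeZero L] in
/-- **The free `t–t'` grand-canonical Hamiltonian is the spin lift of `A_{tt'} − μ`**:
`H_L(1,t',0) − μN = dΓ((A_{tt'} − μ) ⊕ (A_{tt'} − μ))`. [cite: XuEtAl2024, eq. (1)] -/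
theorem hubbardTorusTT'_zero_sub_mu_eq_dGamma (t' μ : ℝ) :
    hubbardTorusTT' L 1 t' 0 - (μ : ℂ) • totalNumber =
      dGamma (Matrix.reindex (toLex : FermionTorus 2 L × Fin 2 ≃ Orb (FermionTorus 2 L)) toLex
        (blockDiagonal fun _ : Fin 2 =>
          TTPrimeFree.ttHopMatrix L 1 t' - (μ : ℂ) • (1 : Matrix (FermionTorus 2 L) (FermionTorus 2 L) ℂ))) := by
  have h1 : hubbardTorusTT' L 1 t' 0 - (μ : ℂ) • totalNumber =
      hamiltonianWith (fermionTorusGraph 2 L) 1 0 μ + hamiltonianWith (fermionTorusDiagGraph L) t' 0 0 := by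
    simp only [hamiltonianWith_eq, hubbardTorusTT', Complex.ofReal_zero, zero_smul, sub_zero]
    abel
  rw [h1, hamiltonianWith_zero_eq_dGamma, hamiltonianWith_zero_eq_dGamma, ← dGamma_add]
  congr 1
  ext o o'
  rw [Matrix.add_apply, hubbardOneBody_apply, hubbardOneBody_apply, reindex_blockDiagonal_apply]
  simp only [TTPrimeFree.ttHopMatrix, LangerMattis.hopMatrix, Matrix.sub_apply, Matrix.add_apply, Matrix.of_apply,
    Matrix.smul_apply, Matrix.one_apply, smul_eq_mul, mul_ite, mul_one, mul_zero, Complex.ofReal_zero,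
    Complex.ofReal_neg, Complex.ofReal_one]
  have ho : o = o' ↔ (ofLex o).1 = (ofLex o').1 ∧ (ofLex o).2 = (ofLex o').2 := by
    constructor
    · intro h; subst h; exact ⟨rfl, rfl⟩
    · rintro ⟨h1, h2⟩; exact ofLex.injective (Prod.ext h1 h2)
  by_cases hσ : (ofLex o).2 = (ofLex o').2
  · by_cases hx : (ofLex o).1 = (ofLex o').1
    · have hoo : o = o' := ho.2 ⟨hx, hσ⟩
      simp [hoo]
    · have hoo : o ≠ o' := fun h => hx (ho.1 h).1
      simp [hσ, hx, hoo]
  · have hoo : o ≠ o' := fun h => hσ (ho.1 h).2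
    simp [hσ, hoo]

end Torus

section SpinLift

variable {Λ : Type*} [LinearOrder Λ] [Fintype Λ]

/-- **Free partition function of a spin-lifted, unitarily diagonalised one-body matrix with chemical potential**:
for `W Wᴴ = 1`, real levels `e` and real `β, μ`,
`Tr e^{−β dΓ((W diag(e) Wᴴ − μ) ⊕ (W diag(e) Wᴴ − μ))} = ∏_{(x,σ)} (1 + e^{−β(e_x − μ)})` (the tree's trace formula
`partitionFn_dGamma_conj_diagonal` on the spin lift `(W ⊕ W) diag(e − μ) (W ⊕ W)⁻¹`).
[cite: AshcroftMermin1976, Ch. 2 eq. (2.49)] -/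
theorem partitionFn_dGamma_spinLift_conj_sub_smul (β μ : ℝ) {W : Matrix Λ Λ ℂ} (hW : W * Wᴴ = 1) (e : Λ → ℝ) :
    partitionFn β (dGamma (Matrix.reindex (toLex : Λ × Fin 2 ≃ Orb Λ) toLex (blockDiagonal fun _ : Fin 2 =>
        W * diagonal (fun k => ((e k : ℝ) : ℂ)) * Wᴴ - (μ : ℂ) • (1 : Matrix Λ Λ ℂ)))) =
      ∏ o : Orb Λ, (((1 + Real.exp (-(β * (e (ofLex o).1 - μ))) : ℝ)) : ℂ) := by
  -- fold `μ` into the diagonal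
  have hdiag : W * diagonal (fun k => ((e k : ℝ) : ℂ)) * Wᴴ - (μ : ℂ) • (1 : Matrix Λ Λ ℂ) =
      W * diagonal (fun k => (((e k - μ : ℝ)) : ℂ)) * Wᴴ := by
    have h1 : (μ : ℂ) • (1 : Matrix Λ Λ ℂ) = W * ((μ : ℂ) • (1 : Matrix Λ Λ ℂ)) * Wᴴ := by
      rw [Matrix.mul_smul, Matrix.mul_one, Matrix.smul_mul, hW]
    rw [h1, ← Matrix.sub_mul, ← Matrix.mul_sub]
    congr 2
    ext i j
    simp only [Matrix.sub_apply, Matrix.diagonal_apply, Matrix.smul_apply, Matrix.one_apply, smul_eq_mul, mul_ite,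
      mul_one, mul_zero]
    split_ifs
    · push_cast; ring
    · simp
  -- the spin lift of `W` is invertible with inverse the spin lift of `Wᴴ`
  have hQQ : Matrix.reindex (toLex : Λ × Fin 2 ≃ Orb Λ) toLex (blockDiagonal fun _ : Fin 2 => W) *
      Matrix.reindex (toLex : Λ × Fin 2 ≃ Orb Λ) toLex (blockDiagonal fun _ : Fin 2 => Wᴴ) = 1 := by
    rw [reindex_blockDiagonal_mul]
    simp only [hW]
    exact reindex_blockDiagonal_one
  have hInv : Invertible (Matrix.reindex (toLex : Λ × Fin 2 ≃ Orb Λ) toLex (blockDiagonal fun _ : Fin 2 => W)) :=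
    invertibleOfRightInverse _ _ hQQ
  have hQunit : IsUnit (Matrix.reindex (toLex : Λ × Fin 2 ≃ Orb Λ) toLex (blockDiagonal fun _ : Fin 2 => W)) :=
    @isUnit_of_invertible _ _ _ hInv
  rw [hdiag, ← reindex_blockDiagonal_mul, ← reindex_blockDiagonal_mul, reindex_blockDiagonal_diagonal,
    ← Matrix.inv_eq_right_inv hQQ]
  exact partitionFn_dGamma_conj_diagonal β hQunit (fun o : Orb Λ => e (ofLex o).1 - μ)

end SpinLift

section Torus

variable {L : ℕ} [NeZero L]

/-- **The free `t–t'` grand-canonical partition function, diagonalised** (`L ≥ 3`):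
`Tr e^{−β(H_L(1,t',0) − μN)} = ∏_{(x,σ)} (1 + e^{−β(ε_L(k_x) − μ)})`. [cite: AshcroftMermin1976, Ch. 2 eq. (2.49)] -/
theorem partitionFn_freeTT'_eq_prod (hL : 3 ≤ L) (β t' μ : ℝ) :
    partitionFn β (hubbardTorusTT' L 1 t' 0 - (μ : ℂ) • totalNumber) =
      ∏ o : Orb (FermionTorus 2 L),
        (((1 + Real.exp (-(β * (TTPrimeFree.ttBand L 1 t' ((ofLex o).1).toTorusSite - μ))) : ℝ)) : ℂ) := by
  have hW : LangerMattis.sitePlaneWave 2 L * (LangerMattis.sitePlaneWave 2 L)ᴴ = 1 :=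
    LangerMattis.sitePlaneWave_mul_conjTranspose
  -- the generic lemma lives on the `LinearOrder`-derived `DecidableEq` path; `convert` bridges the instances
  have h := partitionFn_dGamma_spinLift_conj_sub_smul (Λ := FermionTorus 2 L) β μ (W := LangerMattis.sitePlaneWave 2 L)
    (by convert hW) (fun k => TTPrimeFree.ttBand L 1 t' k.toTorusSite)
  rw [hubbardTorusTT'_zero_sub_mu_eq_dGamma, TTPrimeFree.ttHopMatrix_eq_conj hL 1 t']
  convert h
  rfl

/-- **The free `t–t'` grand-canonical partition function is the plane-wave product** (`L ≥ 3`):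
`log Re Tr e^{−β(H_L(1,t',0) − μN)} = Σ_k freeLogWeightTT' β t' μ (c_k)` (`= Σ_k 2 log(1 + e^{−β(ε_L(k) − μ)})`).
[cite: AshcroftMermin1976, Ch. 2 eq. (2.49)] [cite: FriedliVelenikSMLS2017, §10.5.2] -/
theorem log_partitionFn_freeTT'_eq_sum (hL : 3 ≤ L) (β t' μ : ℝ) :
    Real.log (partitionFn β (hubbardTorusTT' L 1 t' 0 - (μ : ℂ) • totalNumber)).re =
      ∑ k : TorusSite 2 L, freeLogWeightTT' β t' μ (cellCorner k) := by
  rw [partitionFn_freeTT'_eq_prod hL, ← Complex.ofReal_prod, Complex.ofReal_re]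
  have hpos : ∀ o : Orb (FermionTorus 2 L),
      0 < 1 + Real.exp (-(β * (TTPrimeFree.ttBand L 1 t' ((ofLex o).1).toTorusSite - μ))) := fun o => by positivity
  rw [Real.log_prod (s := Finset.univ) (hf := fun o _ => (hpos o).ne'), sum_orb_eq_sum_sum]
  simp only [orb, ofLex_toLex, Finset.sum_const, Finset.card_univ, Fintype.card_fin, nsmul_eq_mul, Nat.cast_ofNat]
  rw [FermionTorus.sum_eq_sum_torusSite]
  refine Finset.sum_congr rfl fun k _ => ?_
  rw [FermionTorus.toTorusSite_ofTorusSite, freeLogWeightTT', ttBand_one_eq_cellCorner]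

/-- **`L⁻² log Ξ_L(β, t', μ) → P₀(β, t', μ)`**: the per-site free grand-canonical log-partition function of the `t–t'`
torus converges to the Brillouin-zone integral (corner Riemann sums of a continuous function).
[cite: FriedliVelenikSMLS2017, §10.5.2] [cite: AshcroftMermin1976, Ch. 2 eq. (2.49)] -/
theorem tendsto_log_partitionFn_freeTT'_div_sq (β t' μ : ℝ) :
    Tendsto (fun L : ℕ => Real.log (partitionFn β (hubbardTorusTT' L 1 t' 0 - (μ : ℂ) • totalNumber)).re / (L : ℝ) ^ 2)
      atTop (𝓝 (freeGCPressureTT' β t' μ)) := by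
  have hR := (tendsto_cornerRiemannSum (d := 2) (continuous_freeLogWeightTT' β t' μ).continuousOn).const_mul
    (((2 * π) ^ 2)⁻¹ : ℝ)
  refine hR.congr' ?_
  filter_upwards [eventually_ge_atTop 3] with L hL
  haveI : NeZero L := ⟨by omega⟩
  rw [log_partitionFn_freeTT'_eq_sum hL, ← HartreeFock.sum_cellCorner_div_eq]

end Torus

/-! ### §3 The free-gas ceilings of the canonical `t–t'` pressure -/

section Ceiling

/-- **The free end at `t' ≠ 0`: `p(β; 1,t',0; n) ≤ P₀(β, t', μ) − βμn` for every real `μ`** (`β ≥ 0`, `0 ≤ n < 2`):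
the canonical sector pressure of the free `t–t'` gas is at most the Legendre bound from its grand-canonical pressure.
[cite: Ruelle1969, §3.4] [cite: AshcroftMermin1976, Ch. 2 eq. (2.49)] -/
theorem pressureTT'_freeTT'_le_freeGCPressureTT'_sub {β : ℝ} (hβ : 0 ≤ β) (t' : ℝ) {n : ℝ} (hn0 : 0 ≤ n) (hn2 : n < 2)
    (μ : ℝ) : pressureTT' β 1 t' 0 n ≤ freeGCPressureTT' β t' μ - β * μ * n := by
  have h := pressureTT'_add_le_of_grandCanonical_ceiling hβ 1 t' le_rfl hn0 hn2 tendsto_id (μ := μ)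
    (q := freeGCPressureTT' β t' μ) fun ε hε => by
      have ht := tendsto_log_partitionFn_freeTT'_div_sq β t' μ
      filter_upwards [ht.eventually (eventually_le_nhds (show freeGCPressureTT' β t' μ < freeGCPressureTT' β t' μ + ε by
        linarith)), eventually_ge_atTop 1] with L hL hL1
      have hL2 : (0 : ℝ) < (L : ℝ) ^ 2 := by
        have : (1 : ℝ) ≤ L := by exact_mod_cast hL1
        positivity
      exact (div_le_iff₀ hL2).1 hL
  linarith

/-- **The free-gas CEILING at every coupling: `p(β; 1,t',U; n) ≤ P₀(β, t', μ) − βμn` for all `U ≥ 0` and every real `μ`**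
(the canonical pressure is antitone in `U`, `pressureTT'_anti_U`). [cite: Lieb1973, §V (5.2)–(5.4)] [cite: Ruelle1969, §3.4] -/
theorem pressureTT'_le_freeGCPressureTT'_sub {β : ℝ} (hβ : 0 ≤ β) (t' : ℝ) {U : ℝ} (hU : 0 ≤ U) {n : ℝ} (hn0 : 0 ≤ n)
    (hn2 : n < 2) (μ : ℝ) : pressureTT' β 1 t' U n ≤ freeGCPressureTT' β t' μ - β * μ * n :=
  (pressureTT'_anti_U hn0 hn2 hβ 1 t' le_rfl hU).trans (pressureTT'_freeTT'_le_freeGCPressureTT'_sub hβ t' hn0 hn2 μ)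

/-- Reader shape: a certified quadrature ceiling `P₀(β, t', μ) ≤ P` gives `p(β; 1,t',U; n) ≤ P − βμn` for every `U ≥ 0`.
[cite: Ruelle1969, §3.4] -/
theorem pressureTT'_le_of_freeGCPressureTT'_le {β : ℝ} (hβ : 0 ≤ β) (t' : ℝ) {U : ℝ} (hU : 0 ≤ U) {n : ℝ} (hn0 : 0 ≤ n)
    (hn2 : n < 2) {μ P : ℝ} (hP : freeGCPressureTT' β t' μ ≤ P) : pressureTT' β 1 t' U n ≤ P - β * μ * n :=
  (pressureTT'_le_freeGCPressureTT'_sub hβ t' hU hn0 hn2 μ).trans (by linarith)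

/-- **The DILUTE-ANCHOR shape** used by the hot-anchored competing-order words: a certified ceiling `P₀(β_h, t', μ) ≤ P`
and any `π ≥ P − β_h μ n` give the anchor hypothesis `p(β_h; 1,t',U; n) ≤ π` of
`HubbardTTPrimeThermalPhaseCoexistenceHotAnchor` at every `U ≥ 0`. [cite: Ruelle1969, §3.4] -/
theorem pressureTT'_le_of_freeGCPressureTT'_le' {β : ℝ} (hβ : 0 ≤ β) (t' : ℝ) {U : ℝ} (hU : 0 ≤ U) {n : ℝ} (hn0 : 0 ≤ n)
    (hn2 : n < 2) {μ P A : ℝ} (hP : freeGCPressureTT' β t' μ ≤ P) (hA : P - β * μ * n ≤ A) : pressureTT' β 1 t' U n ≤ A :=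
  (pressureTT'_le_of_freeGCPressureTT'_le hβ t' hU hn0 hn2 hP).trans hA

end Ceiling

/-! ### §4 The thermal double-occupancy cap from the `t–t'` free-entropy chord -/

namespace InfVolFermionState

variable {t' n β : ℝ}

/-- **The thermal double occupancy is capped by the free-entropy chord, `t–t'` model** (`t = 1`): for every torus limit `ω`
of the canonical sector Gibbs states of `hubbardTorusTT' L 1 t' U` at `β > 0` (`U ≥ 0`, `0 ≤ n < 2`), every real `μ` and
every certified `T = 0` upper bound `e(1,t',U,n) ≤ e^{up}`:
`β·U·D(ω) ≤ P₀(β, t', μ) − βμn + β·e^{up}`. [cite: Lieb1973, §V (5.2)–(5.4)] [cite: Ruelle1969, §3.4] -/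
theorem IsTorusLimitOfMixture.mul_meanEnergy_onSite_le_of_freeGCPressureTT'_of_upper
    (hβ : 0 < β) (hn0 : 0 ≤ n) (hn2 : n < 2) {U : ℝ} (hU : 0 ≤ U) (μ : ℝ) {eup : ℝ}
    (hup : energyDensityTT' 1 t' U n ≤ eup)
    {ω : InfVolFermionState 2} {Ls : ℕ → ℕ}
    (h : ω.IsTorusLimitOfMixture (sectorGibbsCount n) (fun L => sectorGibbsWeightTT' β 1 t' U n L)
      (fun L => sectorGibbsVectorTT' 1 t' U n L) Ls) (hLs : Tendsto Ls atTop atTop) :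
    β * U * ω.meanEnergy (hubbardTTPrimeFermionInteraction 0 0 1) 1 ≤
      freeGCPressureTT' β t' μ - β * μ * n + β * eup := by
  have h1 := h.mul_meanEnergy_onSite_le_pressureTT'_add_of_upper hβ hn0 hn2 le_rfl hU hup hLs
  have h2 := pressureTT'_freeTT'_le_freeGCPressureTT'_sub hβ.le t' hn0 hn2 μ
  rw [sub_zero] at h1
  linarith

/-- **Reader shape of the cap.** With a certified quadrature ceiling `P₀(β, t', μ) ≤ P`, a certified `T = 0` upper
`e(1,t',U,n) ≤ e^{up}` and any `d^{up} ≥ (P − βμn + β e^{up})/(βU)` (`U > 0`): `D(ω) ≤ d^{up}` for every thermal torus limit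
at `(β, 1, t', U, n)`. [cite: Lieb1973, §V (5.2)–(5.4)] [cite: Ruelle1969, §3.4] -/
theorem IsTorusLimitOfMixture.meanEnergy_onSite_le_of_freeGCPressureTT'_le_of_upper
    (hβ : 0 < β) (hn0 : 0 ≤ n) (hn2 : n < 2) {U : ℝ} (hU : 0 < U) {μ P eup dup : ℝ}
    (hP : freeGCPressureTT' β t' μ ≤ P) (hup : energyDensityTT' 1 t' U n ≤ eup)
    (hd : (P - β * μ * n + β * eup) / (β * U) ≤ dup)
    {ω : InfVolFermionState 2} {Ls : ℕ → ℕ}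
    (h : ω.IsTorusLimitOfMixture (sectorGibbsCount n) (fun L => sectorGibbsWeightTT' β 1 t' U n L)
      (fun L => sectorGibbsVectorTT' 1 t' U n L) Ls) (hLs : Tendsto Ls atTop atTop) :
    ω.meanEnergy (hubbardTTPrimeFermionInteraction 0 0 1) 1 ≤ dup := by
  have h1 := h.mul_meanEnergy_onSite_le_of_freeGCPressureTT'_of_upper hβ hn0 hn2 hU.le μ hup hLs
  have hβU : 0 < β * U := mul_pos hβ hU
  refine le_trans ?_ hd
  rw [le_div_iff₀ hβU]
  linarith

/-- **Word shape** (`Re ω_{{0}}(n_{0↑}n_{0↓}) ≤ d^{up}`, the hypothesis shape of the KT back-end's d-route factories), `t–t'`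
model. [cite: Lieb1973, §V (5.2)–(5.4)] [cite: Ruelle1969, §3.4] -/
theorem IsTorusLimitOfMixture.re_expect_docc_le_of_freeGCPressureTT'_le_of_upper
    (hβ : 0 < β) (hn0 : 0 ≤ n) (hn2 : n < 2) {U : ℝ} (hU : 0 < U) {μ P eup dup : ℝ}
    (hP : freeGCPressureTT' β t' μ ≤ P) (hup : energyDensityTT' 1 t' U n ≤ eup)
    (hd : (P - β * μ * n + β * eup) / (β * U) ≤ dup)
    {ω : InfVolFermionState 2} {Ls : ℕ → ℕ}
    (h : ω.IsTorusLimitOfMixture (sectorGibbsCount n) (fun L => sectorGibbsWeightTT' β 1 t' U n L)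
      (fun L => sectorGibbsVectorTT' 1 t' U n L) Ls) (hLs : Tendsto Ls atTop atTop) :
    (ω.expect ({0} : Finset (Site 2))
      (nAt 0 (Finset.mem_singleton_self 0) 0 * nAt 0 (Finset.mem_singleton_self 0) 1)).re ≤ dup := by
  rw [← h.meanEnergy_onSite_eq_re_expect_docc hLs]
  exact h.meanEnergy_onSite_le_of_freeGCPressureTT'_le_of_upper hβ hn0 hn2 hU hP hup hd hLs

end InfVolFermionState

end Literature.MathematicalPhysics.QuantumLattice

end
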